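import Summits.HubbardSuperconductivity.HubbardSuperconductivity.Theorems.FunctionFieldCertificateMesoscopicPairOrderScaleLadderBlocks
import HarnessLib

/-!
# Crux `MesoscopicPairOrder` (stmt-HubbardSuperconductivity-7331) — the scale ladder of the Fejér-box functional

Support file 2 of 2 (route `FunctionFieldCertificate`, pole-free half; line `Sketch`, lead c1).
The crux asks, at one `(U, δ)`, for a margin `m R²` of the Fejér-box `d`-wave pair functional
`T_R(ψ) = Σ_{x,y} Πᵢ (1 - |(y - x)ᵢ|_L/R)₊ Re⟨P_x ψ, P_y ψ⟩` in every normalised sector ground state,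
for ARBITRARILY LARGE scales `R` (`∀ R₀ ∃ R ≥ R₀`). From the two-scale block inequalities of file 1
(`sum_block_mul_le`, `sum_block_le_of_mul_le`) and the tent identity `Σ_a ‖B_R(a)ψ‖² = R² T_R(ψ)`
(`FunctionFieldCertificateAssembly.re_sum_star_blockMulVec_dotProduct_eq`) this file proves the
model-free SCALE LADDER of `T_R` on `(ℤ/Lℤ)²` and its consequence for the crux:

* `fejerBox_mul_antitone` — EXACT multiplicative monotonicity `T_{kR'}(ψ)/(kR')² ≤ T_{R'}(ψ)/R'²`
  (`2kR' ≤ L`; in Fourier language `F_{kR'}(θ) = F_k(R'θ) F_{R'}(θ) ≤ F_{R'}(θ)`): along `R ↦ kR`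
  the best constant of the crux can only DEcrease;
* `fejerBox_scale_transfer` — for ANY two scales `0 < R' ≤ R`, `2R ≤ L`:
  `T_R(ψ)/R² ≤ 2 T_{R'}(ψ)/R'² + 8 (R'/R)² Σ_x ‖P_x ψ‖²` (the remainder is the price of `R' ∤ R`,
  paid by the local weight only);
* `sum_re_star_localPair_mulVec_le` — the local weight of a unit vector, `Σ_x ‖P_x ψ‖² ≤ C_g² L²`;
* `forall_scale_of_frequently_scale`, `mesoscopicPairOrder_iff_forall_scale` — consequently the
  crux's `∀ R₀ ∃ R ≥ R₀` is NOT an escape hatch: `MesoscopicPairOrder` is EQUIVALENT to its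
  every-scale form (margin `m ↦ m/4`). For a refuter: the crux at `(U, δ)` is the one-number
  statement `inf_{R ≥ 1} liminf_{L even} min_GS T_R/(R²L²) > 0`, so driving `min_GS T_R/(R²L²)`
  below every `m > 0` along infinitely many even `L` at ANY single fixed scale `R ≥ 1` kills it
  there; for a prover: nothing is gained by choosing convenient scales.

Sources: Stein–Shakarchi, *Fourier Analysis*, Ch. 2–3 (Fejér kernel; `F_{kR} = F_k(R·) F_R`);
Kennedy–Lieb–Shastry, PRL 61 (1988) 2582. Folklore; no definition is introduced (the functional
is written inline, verbatim as in the route item).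
-/

noncomputable section

-- the summit namespace `Summit.HubbardSuperconductivity.HubbardSuperconductivity.…` repeats the problem name by design (D-0017)
set_option linter.dupNamespace false

namespace Summit.HubbardSuperconductivity.HubbardSuperconductivity.Theorems.FunctionFieldCertificate

open Matrix Finset Filter
open Literature.Probability.LatticeModels Literature.MathematicalPhysics.QuantumLattice
open Summit.HubbardSuperconductivity.HubbardSuperconductivity.Theses.FunctionFieldCertificate
open scoped ComplexOrder

/-! ### The scale ladder of the Fejér-box functional -/

section Ladder

variable {n : Type*} [Fintype n] (L : ℕ) [NeZero L]

/-- **Exact multiplicative monotonicity of the Fejér-box functional.** For any family of matrices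
`P_x` on `(ℤ/Lℤ)²`, any vector `ψ`, `0 < R'`, `0 < k`, `2kR' ≤ L`:
`T_{kR'}(ψ)/(kR')² ≤ T_{R'}(ψ)/R'²`, `T_R(ψ) = Σ_{x,y} Πᵢ (1 - |(y - x)ᵢ|_L/R)₊ Re⟨P_x ψ, P_y ψ⟩`
(tent identity `Σ_a ‖B_R(a)ψ‖² = R² T_R(ψ)` at both scales and `sum_block_mul_le`; in Fourier
language `F_{kR'} = F_k(R'·) F_{R'} ≤ F_{R'}`). Along `R ↦ kR` the best constant of the crux can only
DEcrease. Stein–Shakarchi, *Fourier Analysis*, Ch. 2–3. [folklore] -/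
theorem fejerBox_mul_antitone (k R' : ℕ) (hR' : 0 < R') (hk : 0 < k) (hRL : 2 * (k * R') ≤ L)
    (P : TorusSite 2 L → Matrix n n ℂ) (ψ : n → ℂ) :
    (∑ x : TorusSite 2 L, ∑ y : TorusSite 2 L,
        (∏ i : Fin 2, max 0 (1 - |(((y i - x i).valMinAbs : ℤ) : ℝ)| / ((k * R' : ℕ) : ℝ))) *
          (star (P x *ᵥ ψ) ⬝ᵥ (P y *ᵥ ψ)).re) / ((k * R' : ℕ) : ℝ) ^ 2 ≤
      (∑ x : TorusSite 2 L, ∑ y : TorusSite 2 L,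
        (∏ i : Fin 2, max 0 (1 - |(((y i - x i).valMinAbs : ℤ) : ℝ)| / (R' : ℝ))) *
          (star (P x *ᵥ ψ) ⬝ᵥ (P y *ᵥ ψ)).re) / (R' : ℝ) ^ 2 := by
  have hkR : 0 < k * R' := Nat.mul_pos hk hR'
  have hR'L : 2 * R' ≤ L := le_trans (Nat.mul_le_mul_left 2 (Nat.le_mul_of_pos_left R' hk)) hRL
  have hbig := FunctionFieldCertificateAssembly.re_sum_star_blockMulVec_dotProduct_eq (k * R') hkR hRL P ψ
  have hsmall := FunctionFieldCertificateAssembly.re_sum_star_blockMulVec_dotProduct_eq R' hR' hR'L P ψ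
  have hle := sum_block_mul_le (L := L) k R' P ψ
  rw [← Complex.re_sum, ← Complex.re_sum, hbig, hsmall] at hle
  -- `(kR')² T_{kR'} ≤ k⁴ R'² T_{R'}`
  have hkpos : (0 : ℝ) < k := Nat.cast_pos.2 hk
  have hR'pos : (0 : ℝ) < R' := Nat.cast_pos.2 hR'
  rw [Nat.cast_mul] at hle ⊢
  rw [div_le_div_iff₀ (by positivity) (by positivity)]
  have key : (k : ℝ) ^ 2 * ((∑ x : TorusSite 2 L, ∑ y : TorusSite 2 L,
        (∏ i : Fin 2, max 0 (1 - |(((y i - x i).valMinAbs : ℤ) : ℝ)| / ((k : ℝ) * (R' : ℝ)))) *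
          (star (P x *ᵥ ψ) ⬝ᵥ (P y *ᵥ ψ)).re) * (R' : ℝ) ^ 2) ≤
      (k : ℝ) ^ 2 * ((∑ x : TorusSite 2 L, ∑ y : TorusSite 2 L,
        (∏ i : Fin 2, max 0 (1 - |(((y i - x i).valMinAbs : ℤ) : ℝ)| / (R' : ℝ))) *
          (star (P x *ᵥ ψ) ⬝ᵥ (P y *ᵥ ψ)).re) * ((k : ℝ) * (R' : ℝ)) ^ 2) := by
    have e1 : ∀ T : ℝ, (k : ℝ) ^ 2 * (T * (R' : ℝ) ^ 2) = ((k : ℝ) * (R' : ℝ)) ^ 2 * T := fun T => by ring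
    have e2 : ∀ T : ℝ, (k : ℝ) ^ 2 * (T * ((k : ℝ) * (R' : ℝ)) ^ 2) = (k : ℝ) ^ 4 * ((R' : ℝ) ^ 2 * T) :=
      fun T => by ring
    rw [e1, e2]
    exact hle
  exact le_of_mul_le_mul_left key (by positivity)

/-- **Scale transfer between two arbitrary scales.** For any family of matrices `P_x` on
`(ℤ/Lℤ)²`, any vector `ψ`, and scales `0 < R' ≤ R`, `2R ≤ L`:
`T_R(ψ)/R² ≤ 2 · T_{R'}(ψ)/R'² + 8 (R'/R)² · Σ_x Re⟨P_x ψ, P_x ψ⟩`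
(`q = ⌊R/R'⌋`, `sum_block_le_of_mul_le` with `(R² - q²R'²)² ≤ 4R'²R²`, `q⁴R'⁴ ≤ R⁴`, and the tent
identity at both scales). The remainder is the price of `R' ∤ R`; it is paid by the LOCAL weight
only. Stein–Shakarchi, *Fourier Analysis*, Ch. 2–3. [folklore] -/
theorem fejerBox_scale_transfer (R R' : ℕ) (hR' : 0 < R') (hRR : R' ≤ R) (hRL : 2 * R ≤ L)
    (P : TorusSite 2 L → Matrix n n ℂ) (ψ : n → ℂ) :
    (∑ x : TorusSite 2 L, ∑ y : TorusSite 2 L,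
        (∏ i : Fin 2, max 0 (1 - |(((y i - x i).valMinAbs : ℤ) : ℝ)| / (R : ℝ))) *
          (star (P x *ᵥ ψ) ⬝ᵥ (P y *ᵥ ψ)).re) / (R : ℝ) ^ 2 ≤
      2 * ((∑ x : TorusSite 2 L, ∑ y : TorusSite 2 L,
        (∏ i : Fin 2, max 0 (1 - |(((y i - x i).valMinAbs : ℤ) : ℝ)| / (R' : ℝ))) *
          (star (P x *ᵥ ψ) ⬝ᵥ (P y *ᵥ ψ)).re) / (R' : ℝ) ^ 2) +
      8 * ((R' : ℝ) / (R : ℝ)) ^ 2 * ∑ x : TorusSite 2 L, (star (P x *ᵥ ψ) ⬝ᵥ (P x *ᵥ ψ)).re := by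
  have hR : 0 < R := lt_of_lt_of_le hR' hRR
  have hR'L : 2 * R' ≤ L := le_trans (by omega) hRL
  set q : ℕ := R / R' with hqdef
  have hq : q * R' ≤ R := Nat.div_mul_le_self R R'
  have hdm : R' * q + R % R' = R := by rw [hqdef]; exact Nat.div_add_mod R R'
  have hmod : R % R' < R' := Nat.mod_lt R hR'
  -- block form
  have hblock := sum_block_le_of_mul_le (L := L) R R' q hq P ψ
  rw [← Complex.re_sum, ← Complex.re_sum,
    FunctionFieldCertificateAssembly.re_sum_star_blockMulVec_dotProduct_eq R hR hRL P ψ,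
    FunctionFieldCertificateAssembly.re_sum_star_blockMulVec_dotProduct_eq R' hR' hR'L P ψ] at hblock
  -- abbreviations
  set T : ℝ := ∑ x : TorusSite 2 L, ∑ y : TorusSite 2 L,
        (∏ i : Fin 2, max 0 (1 - |(((y i - x i).valMinAbs : ℤ) : ℝ)| / (R : ℝ))) *
          (star (P x *ᵥ ψ) ⬝ᵥ (P y *ᵥ ψ)).re with hT
  set T' : ℝ := ∑ x : TorusSite 2 L, ∑ y : TorusSite 2 L,
        (∏ i : Fin 2, max 0 (1 - |(((y i - x i).valMinAbs : ℤ) : ℝ)| / (R' : ℝ))) *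
          (star (P x *ᵥ ψ) ⬝ᵥ (P y *ᵥ ψ)).re with hT'
  set S₀ : ℝ := ∑ x : TorusSite 2 L, (star (P x *ᵥ ψ) ⬝ᵥ (P x *ᵥ ψ)).re with hS₀
  have hRpos : (0 : ℝ) < R := Nat.cast_pos.2 hR
  have hR'pos : (0 : ℝ) < R' := Nat.cast_pos.2 hR'
  have hR2 : (0 : ℝ) < (R : ℝ) ^ 2 := by positivity
  have hR'2 : (0 : ℝ) < (R' : ℝ) ^ 2 := by positivity
  -- `T' ≥ 0` (it is a sum of squares over blocks) and `S₀ ≥ 0`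
  have hT'nn : 0 ≤ T' := by
    have h := FunctionFieldCertificateAssembly.re_sum_star_blockMulVec_dotProduct_eq R' hR' hR'L P ψ
    have hnn : 0 ≤ (∑ a : TorusSite 2 L, star ((∑ u : Fin 2 → Fin R', P (a + fun i => ((u i : ℕ) : ZMod L))) *ᵥ ψ) ⬝ᵥ
        ((∑ u : Fin 2 → Fin R', P (a + fun i => ((u i : ℕ) : ZMod L))) *ᵥ ψ)).re := by
      rw [Complex.re_sum]
      exact Finset.sum_nonneg fun a _ => (Complex.nonneg_iff.1 (dotProduct_star_self_nonneg _)).1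
    rw [h] at hnn
    nlinarith
  have hS₀nn : 0 ≤ S₀ := Finset.sum_nonneg fun x _ => (Complex.nonneg_iff.1 (dotProduct_star_self_nonneg _)).1
  -- the remainder count: `R² - q²R'² ≤ 2 R R'`
  have hE : ((R ^ 2 - (q * R') ^ 2 : ℕ) : ℝ) ≤ 2 * R * R' := by
    have hle2 : (q * R') ^ 2 ≤ R ^ 2 := Nat.pow_le_pow_left hq 2
    rw [Nat.cast_sub hle2]
    push_cast
    have hdm' : (R' : ℝ) * q + ((R % R' : ℕ) : ℝ) = R := by exact_mod_cast hdm
    have hmod' : ((R % R' : ℕ) : ℝ) < R' := by exact_mod_cast hmod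
    have h2 : (q : ℝ) * R' ≤ R := by exact_mod_cast hq
    have h3 : (0 : ℝ) ≤ q * R' := by positivity
    nlinarith
  have hEnn : (0 : ℝ) ≤ ((R ^ 2 - (q * R') ^ 2 : ℕ) : ℝ) := Nat.cast_nonneg _
  have hE2 : ((R ^ 2 - (q * R') ^ 2 : ℕ) : ℝ) ^ 2 ≤ 4 * (R : ℝ) ^ 2 * (R' : ℝ) ^ 2 := by
    nlinarith
  -- `q⁴ R'⁴ ≤ R⁴`
  have hq4 : (q : ℝ) ^ 4 * (R' : ℝ) ^ 4 ≤ (R : ℝ) ^ 4 := by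
    have h2 : (q : ℝ) * R' ≤ R := by exact_mod_cast hq
    have h3 : (0 : ℝ) ≤ q * R' := by positivity
    have : ((q : ℝ) * R') ^ 4 ≤ (R : ℝ) ^ 4 := pow_le_pow_left₀ h3 h2 4
    nlinarith
  -- assemble: `R² T ≤ 2 q⁴ R'² T' + 2 E² S₀ ≤ 2 R⁴ T'/R'² + 8 R² R'² S₀`
  have hmain : (R : ℝ) ^ 2 * T ≤ 2 * (q : ℝ) ^ 4 * ((R' : ℝ) ^ 2 * T') +
      2 * ((R ^ 2 - (q * R') ^ 2 : ℕ) : ℝ) ^ 2 * S₀ := hblock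
  have h1 : 2 * (q : ℝ) ^ 4 * ((R' : ℝ) ^ 2 * T') ≤ 2 * (R : ℝ) ^ 2 * T' / (R' : ℝ) ^ 2 * (R : ℝ) ^ 2 := by
    rw [show 2 * (R : ℝ) ^ 2 * T' / (R' : ℝ) ^ 2 * (R : ℝ) ^ 2 = (2 * (R : ℝ) ^ 4 * T') / (R' : ℝ) ^ 2 by ring,
      le_div_iff₀ hR'2]
    have : 0 ≤ T' * (R' : ℝ) ^ 2 := by positivity
    nlinarith
  have h2 : 2 * ((R ^ 2 - (q * R') ^ 2 : ℕ) : ℝ) ^ 2 * S₀ ≤ 8 * (R' : ℝ) ^ 2 * S₀ * (R : ℝ) ^ 2 := by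
    nlinarith
  have h3 : (R : ℝ) ^ 2 * T ≤ (R : ℝ) ^ 2 * (2 * (R : ℝ) ^ 2 * T' / (R' : ℝ) ^ 2 + 8 * (R' : ℝ) ^ 2 * S₀) := by
    nlinarith [hmain, h1, h2]
  have h4 : T ≤ 2 * (R : ℝ) ^ 2 * T' / (R' : ℝ) ^ 2 + 8 * (R' : ℝ) ^ 2 * S₀ := le_of_mul_le_mul_left h3 hR2
  rw [div_le_iff₀ hR2]
  have e : (2 * (T' / (R' : ℝ) ^ 2) + 8 * ((R' : ℝ) / (R : ℝ)) ^ 2 * S₀) * (R : ℝ) ^ 2 =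
      2 * (R : ℝ) ^ 2 * T' / (R' : ℝ) ^ 2 + 8 * (R' : ℝ) ^ 2 * S₀ := by
    field_simp
  rw [e]
  exact h4

end Ladder

/-! ### Consequence for the crux: `∀ R₀ ∃ R ≥ R₀` is the same as `∀ R` -/

section Hubbard

/-- **Local pair weight of a unit vector**: `Σ_x ‖P_x ψ‖² ≤ C_g² L²` for `P_x = localPair g L x`,
`C_g = Σ_{e ∈ {0} ∪ unitSteps} 2|g e|/√2` (`norm_toLp_localPair_mulVec_le`, `L²` sites). For the
`d`-wave form factor `C_g² = 32`. Scalapino, Phys. Rep. 250 (1995) 329, §2. [folklore] -/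
theorem sum_re_star_localPair_mulVec_le (g : Site 2 → ℝ) (L : ℕ) [NeZero L]
    (ψ : Fock (Orb (FermionTorus 2 L))) (hψ : star ψ ⬝ᵥ ψ = 1) :
    ∑ x : TorusSite 2 L, (star (localPair g L x *ᵥ ψ) ⬝ᵥ (localPair g L x *ᵥ ψ)).re ≤
      (∑ e ∈ insert (0 : Site 2) unitSteps, ‖((g e / Real.sqrt 2 : ℝ) : ℂ)‖ * 2) ^ 2 * (L : ℝ) ^ 2 := by
  have h1 : ‖(WithLp.toLp 2 ψ : EuclideanSpace ℂ (Finset (Orb (FermionTorus 2 L))))‖ = 1 := by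
    have h := norm_toLp_sq_eq_re ψ
    rw [hψ, Complex.one_re] at h
    exact (pow_eq_one_iff_of_nonneg (norm_nonneg _) two_ne_zero).1 h
  have hpt : ∀ x : TorusSite 2 L, (star (localPair g L x *ᵥ ψ) ⬝ᵥ (localPair g L x *ᵥ ψ)).re ≤
      (∑ e ∈ insert (0 : Site 2) unitSteps, ‖((g e / Real.sqrt 2 : ℝ) : ℂ)‖ * 2) ^ 2 := by
    intro x
    rw [← norm_toLp_sq_eq_re]
    have h := norm_toLp_localPair_mulVec_le g L x ψ
    rw [h1, mul_one] at h
    exact pow_le_pow_left₀ (norm_nonneg _) h 2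
  calc ∑ x : TorusSite 2 L, (star (localPair g L x *ᵥ ψ) ⬝ᵥ (localPair g L x *ᵥ ψ)).re
      ≤ ∑ x : TorusSite 2 L, (∑ e ∈ insert (0 : Site 2) unitSteps, ‖((g e / Real.sqrt 2 : ℝ) : ℂ)‖ * 2) ^ 2 :=
        Finset.sum_le_sum fun x _ => hpt x
    _ = _ := by
        rw [Finset.sum_const, Finset.card_univ, Fintype.card_fun, ZMod.card, Fintype.card_fin, nsmul_eq_mul,
          Nat.cast_pow]
        ring

/-- **Arbitrarily large good scales give ALL scales** (at fixed `(U, δ)`, margin `m ↦ m/4`). If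
for arbitrarily large `R` eventually (in even `L`) every normalised `(N_L, 0)`-sector ground state
has `m R² ≤ T_R(ψ)/L²`, then the same holds at EVERY scale `R ≥ 1` with margin `m/4`: ask for a good
scale `R̃ ≥ R` with `R̃² ≥ 16 R² C_d²/m` and transfer down by `fejerBox_scale_transfer`
(`T_{R̃}/R̃² ≤ 2T_R/R² + 8(R/R̃)² · C_d² L²`). [folklore] -/
theorem forall_scale_of_frequently_scale {U δ m : ℝ} (hm : 0 < m)
    (h : ∀ R₀ : ℕ, ∃ R : ℕ, R₀ ≤ R ∧ ∃ L₀ : ℕ, ∀ (L : ℕ) [NeZero L], L₀ ≤ L → Even L →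
      ∀ ψ : Fock (Orb (FermionTorus 2 L)), star ψ ⬝ᵥ ψ = 1 →
        IsGroundStateInSector (hubbardTorus 2 L 1 U) (2 * ⌊(1 - δ) * (L : ℝ) ^ 2 / 2⌋₊) 0 ψ →
          m * (R : ℝ) ^ 2 ≤ (∑ x : TorusSite 2 L, ∑ y : TorusSite 2 L,
            (∏ i : Fin 2, max 0 (1 - |(((y i - x i).valMinAbs : ℤ) : ℝ)| / (R : ℝ))) *
              (star (localPair dWaveFormFactor L x *ᵥ ψ) ⬝ᵥ (localPair dWaveFormFactor L y *ᵥ ψ)).re) /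
                (L : ℝ) ^ 2) :
    ∀ R : ℕ, 0 < R → ∃ L₀ : ℕ, ∀ (L : ℕ) [NeZero L], L₀ ≤ L → Even L →
      ∀ ψ : Fock (Orb (FermionTorus 2 L)), star ψ ⬝ᵥ ψ = 1 →
        IsGroundStateInSector (hubbardTorus 2 L 1 U) (2 * ⌊(1 - δ) * (L : ℝ) ^ 2 / 2⌋₊) 0 ψ →
          m / 4 * (R : ℝ) ^ 2 ≤ (∑ x : TorusSite 2 L, ∑ y : TorusSite 2 L,
            (∏ i : Fin 2, max 0 (1 - |(((y i - x i).valMinAbs : ℤ) : ℝ)| / (R : ℝ))) *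
              (star (localPair dWaveFormFactor L x *ᵥ ψ) ⬝ᵥ (localPair dWaveFormFactor L y *ᵥ ψ)).re) /
                (L : ℝ) ^ 2 := by
  intro R hR
  set C : ℝ := (∑ e ∈ insert (0 : Site 2) unitSteps, ‖((dWaveFormFactor e / Real.sqrt 2 : ℝ) : ℂ)‖ * 2) ^ 2
    with hC
  have hCnn : 0 ≤ C := by positivity
  -- a good scale `R̃ ≥ R` with `R̃ ≥ 16 R² C / m` (hence `R̃² ≥ 16 R² C / m`)
  obtain ⟨N, hN⟩ := exists_nat_ge (16 * (R : ℝ) ^ 2 * C / m)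
  obtain ⟨Rt, hRt, L₀, hL⟩ := h (max R (max N 1))
  have hRtR : R ≤ Rt := le_of_max_le_left hRt
  have hRtN : N ≤ Rt := le_of_max_le_left (le_of_max_le_right hRt)
  have hRt1 : 1 ≤ Rt := le_of_max_le_right (le_of_max_le_right hRt)
  refine ⟨max L₀ (2 * Rt), fun L _ hL₀ hE ψ hψ hgs => ?_⟩
  have hLL : L₀ ≤ L := le_of_max_le_left hL₀
  have hRtL : 2 * Rt ≤ L := le_of_max_le_right hL₀
  have hLpos : (0 : ℝ) < L := Nat.cast_pos.2 (Nat.pos_of_ne_zero (NeZero.ne L))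
  have hL2 : (0 : ℝ) < (L : ℝ) ^ 2 := by positivity
  have hRpos : (0 : ℝ) < R := Nat.cast_pos.2 hR
  have hRtpos : (0 : ℝ) < Rt := Nat.cast_pos.2 (lt_of_lt_of_le Nat.one_pos hRt1)
  -- the crux at the good scale, the transfer down to `R`, and the local weight bound
  have hcrux := hL L hLL hE ψ hψ hgs
  have htr := fejerBox_scale_transfer L Rt R hR hRtR hRtL (localPair dWaveFormFactor L) ψ
  have hS₀ := sum_re_star_localPair_mulVec_le dWaveFormFactor L ψ hψ
  rw [← hC] at hS₀
  -- abbreviations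
  set T : ℝ := ∑ x : TorusSite 2 L, ∑ y : TorusSite 2 L,
        (∏ i : Fin 2, max 0 (1 - |(((y i - x i).valMinAbs : ℤ) : ℝ)| / (R : ℝ))) *
          (star (localPair dWaveFormFactor L x *ᵥ ψ) ⬝ᵥ (localPair dWaveFormFactor L y *ᵥ ψ)).re with hT
  set Tt : ℝ := ∑ x : TorusSite 2 L, ∑ y : TorusSite 2 L,
        (∏ i : Fin 2, max 0 (1 - |(((y i - x i).valMinAbs : ℤ) : ℝ)| / (Rt : ℝ))) *
          (star (localPair dWaveFormFactor L x *ᵥ ψ) ⬝ᵥ (localPair dWaveFormFactor L y *ᵥ ψ)).re with hTt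
  set S₀ : ℝ := ∑ x : TorusSite 2 L,
      (star (localPair dWaveFormFactor L x *ᵥ ψ) ⬝ᵥ (localPair dWaveFormFactor L x *ᵥ ψ)).re with hS₀def
  have hS₀nn : 0 ≤ S₀ := Finset.sum_nonneg fun x _ => (Complex.nonneg_iff.1 (dotProduct_star_self_nonneg _)).1
  -- `16 R² C ≤ m Rt²`
  have h16 : 16 * (R : ℝ) ^ 2 * C ≤ m * (Rt : ℝ) ^ 2 := by
    have h1 : (N : ℝ) ≤ Rt := by exact_mod_cast hRtN
    have h2 : (1 : ℝ) ≤ Rt := by exact_mod_cast hRt1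
    have h3 : 16 * (R : ℝ) ^ 2 * C / m ≤ (Rt : ℝ) ^ 2 :=
      calc 16 * (R : ℝ) ^ 2 * C / m ≤ N := hN
        _ ≤ Rt := h1
        _ ≤ (Rt : ℝ) ^ 2 := by nlinarith
    rw [div_le_iff₀ hm] at h3
    linarith
  -- from the crux: `m L² ≤ Tt / Rt²`
  have h1 : m * (L : ℝ) ^ 2 ≤ Tt / (Rt : ℝ) ^ 2 := by
    rw [le_div_iff₀ hL2] at hcrux
    rw [le_div_iff₀ (by positivity)]
    linarith
  -- the remainder is at most `m L² / 2`
  have h2 : 8 * ((R : ℝ) / (Rt : ℝ)) ^ 2 * S₀ ≤ m * (L : ℝ) ^ 2 / 2 := by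
    have hRt2' : (0 : ℝ) < (Rt : ℝ) ^ 2 := by positivity
    have ha : 8 * ((R : ℝ) / (Rt : ℝ)) ^ 2 * S₀ ≤ 8 * ((R : ℝ) / (Rt : ℝ)) ^ 2 * (C * (L : ℝ) ^ 2) :=
      mul_le_mul_of_nonneg_left hS₀ (by positivity)
    have hb : 8 * ((R : ℝ) / (Rt : ℝ)) ^ 2 * (C * (L : ℝ) ^ 2) ≤ m * (L : ℝ) ^ 2 / 2 := by
      have hx : 8 * ((R : ℝ) / (Rt : ℝ)) ^ 2 * (C * (L : ℝ) ^ 2) =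
          (16 * (R : ℝ) ^ 2 * C) * (L : ℝ) ^ 2 / (2 * (Rt : ℝ) ^ 2) := by
        field_simp
        ring
      rw [hx, div_le_div_iff₀ (by positivity) two_pos]
      have := mul_le_mul_of_nonneg_right h16 (by positivity : (0 : ℝ) ≤ 2 * (L : ℝ) ^ 2)
      linarith
    exact ha.trans hb
  -- combine: `m L² ≤ 2 T/R² + m L²/2`
  have h3 : m * (L : ℝ) ^ 2 / 4 ≤ T / (R : ℝ) ^ 2 := by linarith [h1, htr, h2]
  rw [le_div_iff₀ (by positivity)] at h3
  rw [le_div_iff₀ hL2]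
  linarith

/-- **`MesoscopicPairOrder` is equivalent to its every-scale form.** The route item asks for a
margin `m R²` at arbitrarily large scales (`∀ R₀ ∃ R ≥ R₀`); by the scale ladder
(`forall_scale_of_frequently_scale`) this already gives a margin `(m/4) R²` at EVERY scale `R ≥ 1`,
and the converse takes `R = max R₀ 1`. So the crux at `(U, δ)` is the one-number statement
`inf_{R ≥ 1} liminf_{L even} min_GS T_R(ψ)/(R²L²) > 0`; together with `fejerBox_mul_antitone`
(`R ↦ kR` only lowers the ratio) the hard case is `R → ∞`, and a disproof may work at any single
fixed scale. Stein–Shakarchi, *Fourier Analysis*, Ch. 2–3. [folklore] -/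
theorem mesoscopicPairOrder_iff_forall_scale :
    Summit.HubbardSuperconductivity.HubbardSuperconductivity.Theses.FunctionFieldCertificate.MesoscopicPairOrder ↔
      ∃ U : ℝ, 0 < U ∧ ∃ δ ∈ Set.Ioo (0:ℝ) (1 / 2), ∃ m : ℝ, 0 < m ∧ ∀ R : ℕ, 0 < R → ∃ L₀ : ℕ,
        ∀ (L : ℕ) [NeZero L], L₀ ≤ L → Even L →
          ∀ ψ : Fock (Orb (FermionTorus 2 L)), star ψ ⬝ᵥ ψ = 1 →
            IsGroundStateInSector (hubbardTorus 2 L 1 U) (2 * ⌊(1 - δ) * (L : ℝ) ^ 2 / 2⌋₊) 0 ψ →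
              m * (R : ℝ) ^ 2 ≤ (∑ x : TorusSite 2 L, ∑ y : TorusSite 2 L,
                (∏ i : Fin 2, max 0 (1 - |(((y i - x i).valMinAbs : ℤ) : ℝ)| / (R : ℝ))) *
                  (star (localPair dWaveFormFactor L x *ᵥ ψ) ⬝ᵥ (localPair dWaveFormFactor L y *ᵥ ψ)).re) /
                    (L : ℝ) ^ 2 := by
  constructor
  · rintro ⟨U, hU, δ, hδ, m, hm, h⟩
    exact ⟨U, hU, δ, hδ, m / 4, by positivity, forall_scale_of_frequently_scale hm h⟩
  · rintro ⟨U, hU, δ, hδ, m, hm, h⟩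
    refine ⟨U, hU, δ, hδ, m, hm, fun R₀ => ?_⟩
    obtain ⟨L₀, hL⟩ := h (max R₀ 1) (lt_of_lt_of_le Nat.one_pos (le_max_right _ _))
    exact ⟨max R₀ 1, le_max_left _ _, L₀, fun L _ hL₀ hE ψ hψ hgs => hL L hL₀ hE ψ hψ hgs⟩

/-- **Registered form** (sub-goal `mesoscopicPairOrderForallScale` of crux
stmt-HubbardSuperconductivity-7331): `MesoscopicPairOrder` ↔ its every-scale form
(`mesoscopicPairOrder_iff_forall_scale`). [folklore] -/
theorem mesoscopicPairOrderForallScale : Summit.HubbardSuperconductivity.HubbardSuperconductivity.Theses.FunctionFieldCertificate.MesoscopicPairOrder ↔ ∃ U : ℝ, 0 < U ∧ ∃ δ ∈ Set.Ioo (0:ℝ) (1 / 2), ∃ m : ℝ, 0 < m ∧ ∀ R : ℕ, 0 < R → ∃ L₀ : ℕ, ∀ (L : ℕ) [NeZero L], L₀ ≤ L → Even L → ∀ ψ : Fock (Orb (FermionTorus 2 L)), star ψ ⬝ᵥ ψ = 1 → IsGroundStateInSector (hubbardTorus 2 L 1 U) (2 * ⌊(1 - δ) * (L : ℝ) ^ 2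 / 2⌋₊) 0 ψ → m * (R : ℝ) ^ 2 ≤ (∑ x : TorusSite 2 L, ∑ y : TorusSite 2 L, (∏ i : Fin 2, max 0 (1 - |(((y i - x i).valMinAbs : ℤ) : ℝ)| / (R : ℝ))) * (star (localPair dWaveFormFactor L x *ᵥ ψ) ⬝ᵥ (localPair dWaveFormFactor L y *ᵥ ψ)).re) / (L : ℝ) ^ 2 :=
  mesoscopicPairOrder_iff_forall_scale

end Hubbard

end Summit.HubbardSuperconductivity.HubbardSuperconductivity.Theorems.FunctionFieldCertificate
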